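import Summits.FinalStateConjecture.FinalStateConjecture.Theorems.PhaseMixingCaptureCaptureSufficesTameNoC0GlueChart
import Summits.FinalStateConjecture.FinalStateConjecture.Theorems.PhaseMixingCaptureCaptureSufficesTameNoC0FlatCone
import HarnessLib

/-!
# `CaptureSufficesTame` (stmt-FinalStateConjecture-17270), line `only-the-third-law-is-generic`: glue stub
# `stub_noC0_glue` (oriented form), helper file 5 — the time-orientation dichotomy of a chart

The oriented glue stub `stub_noC0_glue_oriented` assumes that `DΦ_y` maps future `Φ^*η`-causal vectors
(`(Φ^*η)(v, v) ≤ 0 < v⁰`) to vectors with positive time component, for every `y` of the control region `Ω`. This file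
supplies what the lead needs to discharge it (namespace `NoC0Glue`):

* `orientation_dichotomy_at` — at each `y ∈ Ω`, `DΦ_y` maps the future `Φ^*η`-causal cone either entirely into
  `{w⁰ > 0}` or entirely into `{w⁰ < 0}` (two cone vectors with images in opposite half spaces combine to a nonzero
  causal vector with vanishing time component);
* `orientation_dichotomy` — on a preconnected `Ω` the alternative is the same at all points (both alternatives are
  open conditions, by continuity of `DΦ`);
* `timeReflection_comp` — composing the chart with the time reflection `x ↦ x − 2x⁰ ∂₀` of Minkowski space (an
  isometry of `η`) keeps `Φ^*η`, smoothness and injectivity and reverses the sign of the time component of `DΦ v`,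
  so that in the second alternative the reflected chart is oriented;
* `stub_noC0_glueOrient` — the dichotomy as a closed statement (registered helper sub-goal).

References: B. O'Neill, *Semi-Riemannian geometry*, 1983, Ch. 5, Lemma 5.26 ff. and p. 145 (timecones, time
orientation); folklore.
-/

-- the doubled `FinalStateConjecture.FinalStateConjecture` path component trips dupNamespace (as in the skeleton)
set_option linter.dupNamespace false
set_option maxSynthPendingDepth 3

noncomputable section

open Set Filter Function Metric
open scoped Topology ContDiff

namespace Summit.FinalStateConjecture.FinalStateConjecture.Theorems.PhaseMixingCaptureCaptureSufficesTame

open Literature.Geometry.Lorentzian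

namespace NoC0Glue

section Orient

variable {M a ε : ℝ} {Ω : Set E4} {Φ : E4 → E4}

/-- **Pointwise orientation dichotomy.** For an `ε`-isometry `Φ` (`ε < 1/5`) of `Ω ⊆` Kerr exterior into Minkowski
space and `y ∈ Ω`: either every future `Φ^*η`-causal `v` (`(Φ^*η)(v,v) ≤ 0 < v⁰`) has `(DΦ_y v)⁰ > 0`, or every such
`v` has `(DΦ_y v)⁰ < 0`. Indeed `(DΦ_y v)⁰ ≠ 0` (a causal vector of `ℝ⁴₁` with vanishing time component vanishes, and
`DΦ_y` is injective), and if `v₁`, `v₂` had images in opposite half spaces, `z = v₂⁰(−v₁) + v₁⁰ v₂` would have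
`z⁰ = 0` and future causal image `v₂⁰(−DΦ v₁) + v₁⁰ DΦ v₂ ≠ 0`, so `z` would be a nonzero `Φ^*η`-causal vector with
`z⁰ = 0`, contradicting `‖z‖ ≤ 2|z⁰|` (brick K2). O'Neill 1983, Ch. 5, Lemma 5.26 ff. [folklore] -/
theorem orientation_dichotomy_at (hM : 0 ≤ M) (hΩext : Ω ⊆ (Kerr.exterior M a : Set E4)) (hε : ε < 1 / 5)
    (hclose : ∀ y ∈ Ω, ‖MetricCoord.pullMetric (fun _ ↦ Minkowski.bilin) Φ y - Kerr.bilin M a y‖ ≤ ε)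
    {y : E4} (hy : y ∈ Ω) :
    (∀ v : E4, MetricCoord.pullMetric (fun _ ↦ Minkowski.bilin) Φ y v v ≤ 0 → 0 < v 0 → 0 < (fderiv ℝ Φ y v) 0) ∨
    (∀ v : E4, MetricCoord.pullMetric (fun _ ↦ Minkowski.bilin) Φ y v v ≤ 0 → 0 < v 0 → (fderiv ℝ Φ y v) 0 < 0) := by
  have hB : ‖MetricCoord.pullMetric (fun _ ↦ Minkowski.bilin) Φ y - Kerr.bilin M a y‖ ≤ 1 / 4 :=
    (hclose y hy).trans (by linarith)
  obtain ⟨e, he⟩ := exists_equiv_fderiv hM hΩext hε hclose hy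
  -- the image of a future `Φ^*η`-causal vector has nonzero time component
  have hne : ∀ v : E4, MetricCoord.pullMetric (fun _ ↦ Minkowski.bilin) Φ y v v ≤ 0 → 0 < v 0 →
      (fderiv ℝ Φ y v) 0 ≠ 0 := by
    intro v hv hv0 h0
    have hw : fderiv ℝ Φ y v = 0 := gen_eq_zero_of_causal_of_time_eq_zero (by simpa using hv) h0
    have hv' : v = 0 := by
      rw [← he] at hw
      simpa using hw
    rw [hv'] at hv0
    simp at hv0
  by_contra hcon
  rw [not_or] at hcon
  obtain ⟨h1, h2⟩ := hcon
  push Not at h1 h2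
  obtain ⟨v₁, hv₁, hv₁0, hle⟩ := h1
  obtain ⟨v₂, hv₂, hv₂0, hge⟩ := h2
  have hlt : (fderiv ℝ Φ y v₁) 0 < 0 := lt_of_le_of_ne hle (hne v₁ hv₁ hv₁0)
  have hgt : 0 < (fderiv ℝ Φ y v₂) 0 := lt_of_le_of_ne hge (fun h ↦ hne v₂ hv₂ hv₂0 h.symm)
  -- the combination `z = v₂⁰ (−v₁) + v₁⁰ v₂`
  set z : E4 := (v₂ 0) • (-v₁) + (v₁ 0) • v₂ with hz
  have hz0 : z 0 = 0 := by
    simp [hz]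
    ring
  have hW : Minkowski.bilin (fderiv ℝ Φ y z) (fderiv ℝ Φ y z) ≤ 0 ∧ 0 < (fderiv ℝ Φ y z) 0 := by
    have h := NoC0Flat.causal_combo (u := fderiv ℝ Φ y (-v₁)) (z := fderiv ℝ Φ y v₂)
      (by simpa using hv₁) (by simp only [map_neg, PiLp.neg_apply]; linarith) (by simpa using hv₂) hgt
      hv₂0.le hv₁0.le (by linarith)
    simpa [hz, map_add, map_smul] using h
  have hzB : MetricCoord.pullMetric (fun _ ↦ Minkowski.bilin) Φ y z z ≤ 0 := by simpa using hW.1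
  have hzn := kerr_norm_le_two_mul_abs_time M a y z _ hM hB hzB
  rw [hz0, abs_zero, mul_zero] at hzn
  have hz' : z = 0 := norm_le_zero_iff.1 hzn
  have h0 : (fderiv ℝ Φ y z) 0 = 0 := by rw [hz', map_zero]; rfl
  linarith [hW.2]

/-- A future timelike probe: for `y ∈ Ω` there is `v` with `(Φ^*η)_y(v, v) = −1`, `v⁰ > 0` and `DΦ_y v = ± ∂₀`
(`v = ±(DΦ_y)⁻¹ ∂₀`). [folklore] -/
theorem exists_probe (hM : 0 ≤ M) (hΩext : Ω ⊆ (Kerr.exterior M a : Set E4)) (hε : ε < 1 / 5)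
    (hclose : ∀ y ∈ Ω, ‖MetricCoord.pullMetric (fun _ ↦ Minkowski.bilin) Φ y - Kerr.bilin M a y‖ ≤ ε)
    {y : E4} (hy : y ∈ Ω) :
    ∃ v : E4, MetricCoord.pullMetric (fun _ ↦ Minkowski.bilin) Φ y v v = -1 ∧ 0 < v 0 ∧
      (fderiv ℝ Φ y v = E4.basisVector 0 ∨ fderiv ℝ Φ y v = -E4.basisVector 0) := by
  have hB : ‖MetricCoord.pullMetric (fun _ ↦ Minkowski.bilin) Φ y - Kerr.bilin M a y‖ ≤ 1 / 4 :=
    (hclose y hy).trans (by linarith)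
  obtain ⟨e, he⟩ := exists_equiv_fderiv hM hΩext hε hclose hy
  set v : E4 := e.symm (E4.basisVector 0) with hv
  have hvv : MetricCoord.pullMetric (fun _ ↦ Minkowski.bilin) Φ y v v = -1 := by
    rw [hv, pullMetric_symm_apply he, Minkowski.bilin_basisVector_zero]
  have hDv : fderiv ℝ Φ y v = E4.basisVector 0 := by
    rw [← he, hv]
    simp
  have hneg_eq : MetricCoord.pullMetric (fun _ ↦ Minkowski.bilin) Φ y (-v) (-v) = -1 := by
    rw [← hvv]
    simp only [map_neg, neg_apply, neg_neg]
  rcases lt_trichotomy (v 0) 0 with hneg | hzero | hpos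
  · refine ⟨-v, hneg_eq, by simp only [PiLp.neg_apply]; linarith, Or.inr ?_⟩
    rw [map_neg, hDv]
  · exfalso
    have hn := kerr_norm_le_two_mul_abs_time M a y v _ hM hB (by rw [hvv]; norm_num)
    rw [hzero, abs_zero, mul_zero] at hn
    have h0 : v = 0 := norm_le_zero_iff.1 hn
    rw [h0] at hvv
    simp at hvv
  · exact ⟨v, hvv, hpos, Or.inl hDv⟩

/-- **Orientation dichotomy on a preconnected control region.** For an `ε`-isometry `Φ` (`ε < 1/5`, `C^∞` on the open
preconnected `Ω ⊆` Kerr exterior): either `DΦ_y` maps future `Φ^*η`-causal vectors to `{w⁰ > 0}` for ALL `y ∈ Ω`, or to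
`{w⁰ < 0}` for all `y ∈ Ω` — the two pointwise alternatives (`orientation_dichotomy_at`) are open conditions in `y`
(test them on the probe `(DΦ_{y₀})⁻¹(±∂₀)`, which stays `Φ^*η`-timelike with image time component of the same sign
for `y` near `y₀` by continuity of `DΦ`). O'Neill 1983, Ch. 5, p. 145 (time orientability). [folklore] -/
theorem orientation_dichotomy (hM : 0 ≤ M) (hΩ : IsOpen Ω) (hΩext : Ω ⊆ (Kerr.exterior M a : Set E4))
    (hΦ : ContDiffOn ℝ ∞ Φ Ω) (hε : ε < 1 / 5)
    (hclose : ∀ y ∈ Ω, ‖MetricCoord.pullMetric (fun _ ↦ Minkowski.bilin) Φ y - Kerr.bilin M a y‖ ≤ ε)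
    (hconn : IsPreconnected Ω) :
    (∀ y ∈ Ω, ∀ v : E4, MetricCoord.pullMetric (fun _ ↦ Minkowski.bilin) Φ y v v ≤ 0 → 0 < v 0 →
      0 < (fderiv ℝ Φ y v) 0) ∨
    (∀ y ∈ Ω, ∀ v : E4, MetricCoord.pullMetric (fun _ ↦ Minkowski.bilin) Φ y v v ≤ 0 → 0 < v 0 →
      (fderiv ℝ Φ y v) 0 < 0) := by
  -- the two alternatives as subsets of `Ω`
  set Sp : Set E4 := {y | y ∈ Ω ∧ ∀ v : E4, MetricCoord.pullMetric (fun _ ↦ Minkowski.bilin) Φ y v v ≤ 0 →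
    0 < v 0 → 0 < (fderiv ℝ Φ y v) 0} with hSp
  set Sm : Set E4 := {y | y ∈ Ω ∧ ∀ v : E4, MetricCoord.pullMetric (fun _ ↦ Minkowski.bilin) Φ y v v ≤ 0 →
    0 < v 0 → (fderiv ℝ Φ y v) 0 < 0} with hSm
  have hcover : Ω ⊆ Sp ∪ Sm := fun y hy ↦
    (orientation_dichotomy_at hM hΩext hε hclose hy).imp (fun h ↦ ⟨hy, h⟩) (fun h ↦ ⟨hy, h⟩)
  have hdisj : ∀ y, y ∈ Sp → y ∈ Sm → False := by
    intro y hp hm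
    obtain ⟨v, hvv, hv0, hD | hD⟩ := exists_probe hM hΩext hε hclose hp.1
    · have h := hm.2 v (by rw [hvv]; norm_num) hv0
      rw [hD] at h
      norm_num at h
    · have h := hp.2 v (by rw [hvv]; norm_num) hv0
      rw [hD] at h
      norm_num at h
  -- continuity of `y ↦ DΦ_y v₀`
  have hD : ContinuousOn (fderiv ℝ Φ) Ω := hΦ.continuousOn_fderiv_of_isOpen hΩ (by simp)
  have hDv : ∀ v₀ : E4, ContinuousOn (fun y ↦ fderiv ℝ Φ y v₀) Ω := fun v₀ ↦ hD.clm_apply continuousOn_const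
  have hq : ∀ v₀ : E4, ContinuousOn (fun y ↦ MetricCoord.pullMetric (fun _ ↦ Minkowski.bilin) Φ y v₀ v₀) Ω := by
    intro v₀
    have h := NoC0Flat.continuous_bilin_self.comp_continuousOn (hDv v₀)
    simpa [Function.comp_def] using h
  have ht : ∀ v₀ : E4, ContinuousOn (fun y ↦ (fderiv ℝ Φ y v₀) 0) Ω := fun v₀ ↦
    NoC0Flat.continuous_apply_zero.comp_continuousOn (hDv v₀)
  -- both alternatives are open
  have hopen : ∀ (σ : ℝ), (σ = 1 ∨ σ = -1) →
      IsOpen {y | y ∈ Ω ∧ ∀ v : E4, MetricCoord.pullMetric (fun _ ↦ Minkowski.bilin) Φ y v v ≤ 0 →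
        0 < v 0 → 0 < σ * (fderiv ℝ Φ y v) 0} := by
    intro σ hσ
    rw [isOpen_iff_mem_nhds]
    rintro y₀ ⟨hy₀, hS⟩
    obtain ⟨v₀, hvv, hv0, hDv₀⟩ := exists_probe hM hΩext hε hclose hy₀
    have hσpos : 0 < σ * (fderiv ℝ Φ y₀ v₀) 0 := hS v₀ (by rw [hvv]; norm_num) hv0
    -- the open neighbourhood where the probe stays timelike with image time component of the same sign
    have hN1 : IsOpen (Ω ∩ (fun y ↦ MetricCoord.pullMetric (fun _ ↦ Minkowski.bilin) Φ y v₀ v₀) ⁻¹' Iio 0) :=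
      (hq v₀).isOpen_inter_preimage hΩ isOpen_Iio
    have hN2 : IsOpen (Ω ∩ (fun y ↦ σ * (fderiv ℝ Φ y v₀) 0) ⁻¹' Ioi 0) :=
      ((continuousOn_const.mul (ht v₀))).isOpen_inter_preimage hΩ isOpen_Ioi
    have hmem : y₀ ∈ (Ω ∩ (fun y ↦ MetricCoord.pullMetric (fun _ ↦ Minkowski.bilin) Φ y v₀ v₀) ⁻¹' Iio 0) ∩
        (Ω ∩ (fun y ↦ σ * (fderiv ℝ Φ y v₀) 0) ⁻¹' Ioi 0) :=
      ⟨⟨hy₀, by simp only [mem_preimage, mem_Iio, hvv]; norm_num⟩, ⟨hy₀, hσpos⟩⟩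
    refine mem_of_superset ((hN1.inter hN2).mem_nhds hmem) ?_
    rintro y ⟨⟨hy, hy1⟩, ⟨-, hy2⟩⟩
    refine ⟨hy, ?_⟩
    have hy1' : MetricCoord.pullMetric (fun _ ↦ Minkowski.bilin) Φ y v₀ v₀ < 0 := hy1
    have hy2' : 0 < σ * (fderiv ℝ Φ y v₀) 0 := hy2
    rcases orientation_dichotomy_at hM hΩext hε hclose hy with h | h
    · rcases hσ with rfl | rfl
      · intro v hv hv0'
        rw [one_mul]
        exact h v hv hv0'
      · have := h v₀ hy1'.le hv0
        nlinarith
    · rcases hσ with rfl | rfl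
      · have := h v₀ hy1'.le hv0
        nlinarith
      · intro v hv hv0'
        have := h v hv hv0'
        nlinarith
  have hSp_open : IsOpen Sp := by
    have h := hopen 1 (Or.inl rfl)
    simp only [one_mul] at h
    exact h
  have hSm_open : IsOpen Sm := by
    have h := hopen (-1) (Or.inr rfl)
    have heq : Sm = {y | y ∈ Ω ∧ ∀ v : E4, MetricCoord.pullMetric (fun _ ↦ Minkowski.bilin) Φ y v v ≤ 0 →
        0 < v 0 → 0 < -1 * (fderiv ℝ Φ y v) 0} := by
      ext y
      simp only [hSm, mem_setOf_eq, neg_one_mul, neg_pos]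
    rw [heq]
    exact h
  -- preconnectedness
  by_cases hm : (Ω ∩ Sm).Nonempty
  · by_cases hp : (Ω ∩ Sp).Nonempty
    · obtain ⟨y, -, hyp, hym⟩ := hconn Sp Sm hSp_open hSm_open hcover hp hm
      exact (hdisj y hyp hym).elim
    · right
      intro y hy
      rcases hcover hy with h | h
      · exact absurd ⟨y, hy, h⟩ hp
      · exact h.2
  · left
    intro y hy
    rcases hcover hy with h | h
    · exact h.2
    · exact absurd ⟨y, hy, h⟩ hm

/-! ## Composing the chart with the time reflection of Minkowski space -/

/-- The time reflection `x ↦ x − 2x⁰ ∂₀` of `E4` as a continuous linear map. [folklore] -/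
theorem timeReflection_eq_clm :
    (fun x : E4 ↦ x - (2 * x 0) • E4.basisVector 0) =
      ⇑(ContinuousLinearMap.id ℝ E4 -
        ((2 : ℝ) • (EuclideanSpace.proj (0 : Fin 4) : E4 →L[ℝ] ℝ)).smulRight (E4.basisVector 0)) := by
  funext x
  simp [mul_smul]

/-- **Reflecting the chart.** Composing `Φ` with the time reflection `T x = x − 2x⁰ ∂₀` of Minkowski space keeps
smoothness and injectivity on `Ω`, leaves `Φ^*η` unchanged (`T` is an isometry of `η`), and reverses the sign of the
time component of `DΦ_y v` — so exactly one of `Φ`, `T ∘ Φ` is oriented in the sense of `stub_noC0_glue_oriented`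
when `Ω` is preconnected (`orientation_dichotomy`). [folklore] -/
theorem timeReflection_comp (hΩ : IsOpen Ω) (hΦ : ContDiffOn ℝ ∞ Φ Ω) :
    ContDiffOn ℝ ∞ ((fun x : E4 ↦ x - (2 * x 0) • E4.basisVector 0) ∘ Φ) Ω ∧
    (InjOn Φ Ω → InjOn ((fun x : E4 ↦ x - (2 * x 0) • E4.basisVector 0) ∘ Φ) Ω) ∧
    ∀ y ∈ Ω,
      MetricCoord.pullMetric (fun _ ↦ Minkowski.bilin) ((fun x : E4 ↦ x - (2 * x 0) • E4.basisVector 0) ∘ Φ) y =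
          MetricCoord.pullMetric (fun _ ↦ Minkowski.bilin) Φ y ∧
        ∀ v : E4, (fderiv ℝ ((fun x : E4 ↦ x - (2 * x 0) • E4.basisVector 0) ∘ Φ) y v) 0 =
          -((fderiv ℝ Φ y v) 0) := by
  set R : E4 →L[ℝ] E4 := ContinuousLinearMap.id ℝ E4 -
    ((2 : ℝ) • (EuclideanSpace.proj (0 : Fin 4) : E4 →L[ℝ] ℝ)).smulRight (E4.basisVector 0) with hR
  have hReq : (fun x : E4 ↦ x - (2 * x 0) • E4.basisVector 0) = ⇑R := timeReflection_eq_clm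
  have hRapp : ∀ x : E4, R x = x - (2 * x 0) • E4.basisVector 0 := fun x ↦ (congrFun hReq x).symm
  rw [hReq]
  refine ⟨R.contDiff.comp_contDiffOn hΦ, fun hinj y₁ hy₁ y₂ hy₂ h ↦ hinj hy₁ hy₂ ?_, fun y hy ↦ ?_⟩
  · -- `R` is injective (indeed an involution)
    have hRR : ∀ x : E4, R (R x) = x := by
      intro x
      rw [hRapp, hRapp]
      have h0 : (x - (2 * x 0) • E4.basisVector 0) 0 = -x 0 := by
        simp
        ring
      rw [h0, show (2 * -x 0) = -(2 * x 0) by ring, neg_smul, sub_neg_eq_add, sub_add_cancel]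
    have h' : R (R (Φ y₁)) = R (R (Φ y₂)) := by
      show R ((⇑R ∘ Φ) y₁) = R ((⇑R ∘ Φ) y₂)
      rw [h]
    rwa [hRR, hRR] at h'
  · have hd : DifferentiableAt ℝ Φ y := (hΦ.contDiffAt (hΩ.mem_nhds hy)).differentiableAt (by simp)
    have hfd : fderiv ℝ (⇑R ∘ Φ) y = R.comp (fderiv ℝ Φ y) := (R.hasFDerivAt.comp y hd.hasFDerivAt).fderiv
    refine ⟨?_, fun v ↦ ?_⟩
    · -- `T` is an isometry of `η` (the tree's `SwallowTheDatum.UniversalWitnessFamily.minkowski_reflect`)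
      have hiso : ∀ u w : E4, Minkowski.bilin (u - (2 * u 0) • E4.basisVector 0) (w - (2 * w 0) • E4.basisVector 0) =
          Minkowski.bilin u w := by
        intro u w
        simp only [map_sub, map_smul, sub_apply, smul_apply, smul_eq_mul, Minkowski.bilin_basisVector_zero_left,
          Minkowski.bilin_symm u (E4.basisVector 0)]
        have h0 : (E4.basisVector 0 : E4) 0 = 1 := by simp
        rw [h0]
        ring
      ext v w
      simp only [MetricCoord.pullMetric_apply, hfd, ContinuousLinearMap.comp_apply, hRapp]
      exact hiso _ _
    · rw [hfd, ContinuousLinearMap.comp_apply, hRapp]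
      simp
      ring

end Orient

end NoC0Glue

open NoC0Glue in
/-- **Orientation dichotomy (registered helper sub-goal `stub_noC0_glueOrient` of the glue stub).** For a `C^∞` map
`Φ` on an open preconnected `Ω ⊆` Kerr exterior (`0 ≤ M`) with `‖Φ^*η − g_{M,a}‖ ≤ ε < 1/5` on `Ω`: either `DΦ_y`
maps future `Φ^*η`-causal vectors (`(Φ^*η)(v,v) ≤ 0 < v⁰`) into `{w⁰ > 0}` for every `y ∈ Ω`, or into `{w⁰ < 0}`
for every `y ∈ Ω` (time orientability of the pulled-back cone field; O'Neill 1983, Ch. 5, p. 145). In the second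
case the reflected chart `(x ↦ x − 2x⁰∂₀) ∘ Φ` is in the first (`NoC0Glue.timeReflection_comp`). [folklore] -/
theorem stub_noC0_glueOrient :
    ∀ (M a : ℝ) (Ω : Set E4) (Φ : E4 → E4) (ε : ℝ), 0 ≤ M → IsOpen Ω → IsPreconnected Ω →
      Ω ⊆ (Kerr.exterior M a : Set E4) → ContDiffOn ℝ ∞ Φ Ω → ε < 1 / 5 →
      (∀ y ∈ Ω, ‖MetricCoord.pullMetric (fun _ ↦ Minkowski.bilin) Φ y - Kerr.bilin M a y‖ ≤ ε) →
      (∀ y ∈ Ω, ∀ v : E4, MetricCoord.pullMetric (fun _ ↦ Minkowski.bilin) Φ y v v ≤ 0 → 0 < v 0 →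
        0 < (fderiv ℝ Φ y v) 0) ∨
      (∀ y ∈ Ω, ∀ v : E4, MetricCoord.pullMetric (fun _ ↦ Minkowski.bilin) Φ y v v ≤ 0 → 0 < v 0 →
        (fderiv ℝ Φ y v) 0 < 0) :=
  fun _ _ _ _ _ hM hΩ hconn hΩext hΦ hε hclose ↦ orientation_dichotomy hM hΩ hΩext hΦ hε hclose hconn

end Summit.FinalStateConjecture.FinalStateConjecture.Theorems.PhaseMixingCaptureCaptureSufficesTame

end
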